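import Literature.NumberTheory.EllipticCurves.KodairaNeronSplitCyclicProofs
import Literature.NumberTheory.EllipticCurves.PastenValuationProductThm115Proofs
import Literature.NumberTheory.EllipticCurves.PadicFiltrationIndexProofs
import Literature.NumberTheory.EllipticCurves.TamagawaNeZeroProofs
import Literature.NumberTheory.DiophantineGeometry.LocalReductionProofs
import HarnessLib

/-!
# T1 JET (cell `bsd-jet`), road K — the Kodaira–Néron ROW DATUM `hΦ` of the END FORMS is a THEOREM:
# for an odd prime `p ∣ c_ℓ(E/ℚ_ℓ)` the component group `E(ℚ_ℓ)/E₀(ℚ_ℓ)` is cyclic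

HONEST FRAMING (programme file §HONESTY, verbatim): «no tranche here proves BSD; ARM L moves the
LITERAL column of an r ≤ 1 census into the kernel-proved-modulo-named-print column.» THEOREMS ONLY
(seat `bsd-jet-pv-2`, session g5; `--supports stmt-BirchSwinnertonDyer-14418`, helper); 0 classes
move. WHAT THIS IS. The three END FORMS of road K
(`JET.jetchevDivisibilityCarrier{Mult,Ne,Add}_of_localFacts`, p517079 / p517404 / p517696) carry ONE
Kodaira–Néron row datum `hΦ`: for `W/ℚ`, primes `ℓ`, `p` with `p ≠ 2` and
`p ∣ c_ℓ = (W⁄ℚ_ℓ).localTamagawaNumber ℤ_ℓ`, and `W⁄ℚ_ℓ` minimal over `ℤ_ℓ`, the quotient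
`E(ℚ_ℓ) ⧸ E₀(ℚ_ℓ)` (`goodReductionSubgroup`) is cyclic. This file PROVES it from Tate's algorithm as
it stands in the tree: either the minimal model has split multiplicative reduction — then `E/E₀` is
cyclic over the Henselian ring `ℤ_ℓ` (`isAddCyclic_quotient_goodReductionSubgroup_of_hasSplitMultiplicativeReduction`,
Silverman *ATAEC* Cor. IV.9.2 (d) with (b)), transported to the given minimal equation
(`hasSplitMultiplicativeReduction_iff_of_isMinimal_of_eq_smul`, *AEC* VII.1.3 (b)) — or
`0 < c_ℓ ≤ 4` (`localTamagawaNumber_padic_le_four`, Cor. IV.9.2 (d)), so an odd prime divisor forces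
`c_ℓ = 3 = [E(ℚ_ℓ) : E₀(ℚ_ℓ)]` (`localTamagawaNumber_eq_index_of_isMinimal`) and a group of prime
order is cyclic. So `hΦ` is discharged BY NAME (`JET.kodairaNeron_isAddCyclic_forall`, stated in the
binder's exact shape). References: [cite: SilvermanATAEC1994, Cor. IV.9.2 (d) with (b) (PDF p. 340)]
[cite: SilvermanAEC2009, VII.1 Prop. 1.3 (b), VII.6 Thm. 6.1].
-/

set_option autoImplicit false

noncomputable section

open scoped Classical

open WeierstrassCurve Literature.NumberTheory.EllipticCurves

namespace Summit.BirchSwinnertonDyer.Rank1Residual.JET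

/-- **Kodaira–Néron: an odd prime divides `c(X/ℚ_ℓ)` only if `X(ℚ_ℓ)/X₀(ℚ_ℓ)` is cyclic.** For an
elliptic curve `X/ℚ_ℓ` given by a `ℤ_ℓ`-minimal equation and an odd prime `p ∣ c(X/ℚ_ℓ)`: either
the reduction is split multiplicative and `X/X₀ ≅ ℤ/ord(Δ)` is cyclic, or `c ≤ 4`, whence
`c = 3` and `X/X₀` has prime order. [cite: SilvermanATAEC1994, Cor. IV.9.2 (d) with (b) (PDF p. 340)]
[cite: SilvermanAEC2009, VII.1 Prop. 1.3 (b)] -/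
theorem isAddCyclic_quotient_goodReductionSubgroup_of_odd_prime_dvd (ℓ : ℕ) [Fact ℓ.Prime]
    (X : WeierstrassCurve ℚ_[ℓ]) [X.IsElliptic] [X.IsMinimal ℤ_[ℓ]] {p : ℕ} (hp : p.Prime)
    (hp2 : p ≠ 2) (hdvd : p ∣ X.localTamagawaNumber ℤ_[ℓ]) :
    IsAddCyclic (X.toAffine.Point ⧸ X.goodReductionSubgroup ℤ_[ℓ]) := by
  by_cases hs : (X.minimal ℤ_[ℓ]).HasSplitMultiplicativeReduction ℤ_[ℓ]
  · -- split multiplicative: transport to the given minimal equation, then Tate normal form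
    have hmin : X.minimal ℤ_[ℓ] = (X.exists_isMinimal ℤ_[ℓ]).choose • X := rfl
    haveI : X.HasSplitMultiplicativeReduction ℤ_[ℓ] :=
      (hasSplitMultiplicativeReduction_iff_of_isMinimal_of_eq_smul ℤ_[ℓ] hmin
        X.isUnit_Δ.ne_zero).mp hs
    exact X.isAddCyclic_quotient_goodReductionSubgroup_of_hasSplitMultiplicativeReduction ℤ_[ℓ]
  · -- otherwise `0 < c ≤ 4`, so `p = c = 3` and the quotient has prime order
    have h4 := localTamagawaNumber_padic_le_four ℓ X hs
    have hne := localTamagawaNumber_padic_ne_zero_holds ℓ X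
    have hle := Nat.le_of_dvd (Nat.pos_of_ne_zero hne) hdvd
    have hp3 : 3 ≤ p := by
      rcases hp.eq_two_or_odd' with h | h
      · exact absurd h hp2
      · exact Nat.succ_le_of_lt (lt_of_le_of_ne hp.two_le (fun h2 ↦ hp2 h2.symm))
    have hc3 : X.localTamagawaNumber ℤ_[ℓ] = 3 := by
      obtain ⟨m, hm⟩ := hdvd
      have hm1 : 1 ≤ m := by
        rcases Nat.eq_zero_or_pos m with h0 | h0
        · rw [h0, mul_zero] at hm; exact absurd hm hne
        · exact h0
      have hm2 : m < 2 := by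
        by_contra hge
        have : 3 * 2 ≤ p * m := Nat.mul_le_mul hp3 (not_lt.mp hge)
        omega
      have hm' : m = 1 := by omega
      rw [hm', mul_one] at hm
      -- `c = p` with `3 ≤ p ≤ 4` prime
      have hp4 : p ≤ 4 := hm ▸ h4
      interval_cases p
      · exact hm
      · exact absurd hp (by decide)
    rw [localTamagawaNumber_eq_index_of_isMinimal] at hc3
    haveI : Fact (Nat.Prime 3) := ⟨Nat.prime_three⟩
    exact isAddCyclic_of_prime_card (p := 3) hc3

/-- **The END FORMS' Kodaira–Néron row datum `hΦ`, by name** (binder shape of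
`JET.jetchevDivisibilityCarrierMult_of_localFacts` and its K1/K4 twins, verbatim): for `W/ℚ`,
primes `ℓ`, `p` with `p ≠ 2`, `p ∣ c_ℓ(W⁄ℚ_ℓ)` and `W⁄ℚ_ℓ` minimal over `ℤ_ℓ`, the component quotient
`E(ℚ_ℓ) ⧸ E₀(ℚ_ℓ)` is cyclic. [cite: SilvermanATAEC1994, Cor. IV.9.2 (d) with (b) (PDF p. 340)] -/
theorem kodairaNeron_isAddCyclic_forall :
    ∀ (W : WeierstrassCurve ℚ) [W.IsElliptic] [W.IsGloballyMinimal] (ℓ p : ℕ) [Fact ℓ.Prime]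
      [Fact p.Prime], p ≠ 2 → p ∣ (W.baseChange ℚ_[ℓ]).localTamagawaNumber ℤ_[ℓ] →
      ∀ [(W.baseChange ℚ_[ℓ]).IsMinimal ℤ_[ℓ]],
      IsAddCyclic ((W.baseChange ℚ_[ℓ]).toAffine.Point ⧸
        (W.baseChange ℚ_[ℓ]).goodReductionSubgroup ℤ_[ℓ]) := by
  intro W _ _ ℓ p _ _ hp2 hdvd _
  haveI : (W.baseChange ℚ_[ℓ]).IsElliptic := by
    unfold WeierstrassCurve.baseChange; infer_instance
  exact isAddCyclic_quotient_goodReductionSubgroup_of_odd_prime_dvd ℓ (W.baseChange ℚ_[ℓ])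
    (Fact.out : p.Prime) hp2 hdvd

end Summit.BirchSwinnertonDyer.Rank1Residual.JET

end
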